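import Summits.KontsevichZagierPeriods.KontsevichZagierPeriods.Theses.SymplecticScissors
import Summits.KontsevichZagierPeriods.KontsevichZagierPeriods.Theorems.PlanarK0Injective.Negative.Kit
import Literature.NumberTheory.Transcendental.BakerLogarithmsConclusion

/-!
# `PlanarK0Injective` (stmt-KontsevichZagierPeriods-9847) — line `mordell-weil-normal-form`,
CORRECTED COMPOSITION suggested by the refuter (drefute, 2026-08-16)

This is the lead's skeleton `Lines/mordell-weil-normal-form.lean` with the refuter's correction applied
(see `DREFUTE-mordell-weil-normal-form.md`, `DrefuteFormalIndependence.lean`):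

* `stub_huberWustholz` and shape (3) (formal independence of period symbols) of
  `stub_mordellWeilNormalForm` are DELETED — modulo soundness of R1–R5 shape (3) is implied by shape (1),
  and modulo HW it implies shape (1), so the Huber–Wüstholz stub never lowered the obligation;
* `stub_toricIndependence` is PROVED from the tree's `baker_holds` (no longer a stub);
* the composition `PlanarK0Injective_of` is unchanged otherwise and stays sorry-free.

Remaining stubs: `stub_cellReading` (L/XL, CAD), `stub_scalarCalculus` (M, stacking shears),
`stub_mordellWeilNormalForm'` (crux-equivalent core: normal basis with areas certified independent either
numerically over `ℚ̄ ∩ ℝ` (shape (1)) or torically (shape (2))). Not a replacement of the registered skeleton —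
the lead decides; published for adoption.
-/

noncomputable section

open MeasureTheory Set
open Literature.NumberTheory.Transcendental Complex
open Summit.KontsevichZagierPeriods.SymplecticScissors.PlanarK0InjectiveNegative (planarGroup
  eval_eq_zero_of_mem_planarGroup)
open Summit.KontsevichZagierPeriods.KontsevichZagierPeriods.Theses.SymplecticScissors (PlanarK0Injective)

namespace Summit.KontsevichZagierPeriods.SymplecticScissors.MordellWeilCorrected

/-! ## The three stubs (and Baker's theorem in real clothes, proved) -/

/-- **Stub 1 (cell reading).** Every planar set (integrand `1`) is congruent modulo the planar
set-chain group to a finite sum of standard cells `{0 < x < 1, 0 < y < g x}` with `g`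
`ℚ`-semialgebraic, `C¹`, positive and integrable on `(0,1)`. [folklore] -/
theorem stub_cellReading :
    ∀ (r : KZ.IntegralRep 2), (∀ p ∈ r.domain, r.integrand p = 1) →
      ∃ (n : ℕ) (g : Fin n → ℝ → ℝ) (c : Fin n → KZ.IntegralRep 2),
        (∀ i, IsSemialgebraicFunOn ℚ {z : Fin 1 → ℝ | z 0 ∈ Set.Ioo (0 : ℝ) 1} (fun z => g i (z 0)) ∧
          ContDiffOn ℝ 1 (g i) (Set.Ioo (0 : ℝ) 1) ∧ (∀ x ∈ Set.Ioo (0 : ℝ) 1, 0 < g i x) ∧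
          IntegrableOn (g i) (Set.Ioo (0 : ℝ) 1)) ∧
        (∀ i, (c i).domain = {p : Fin 2 → ℝ | p 0 ∈ Set.Ioo (0 : ℝ) 1 ∧ 0 < p 1 ∧ p 1 < g i (p 0)} ∧
          ∀ p ∈ (c i).domain, (c i).integrand p = 1) ∧
        KZ.of r - ∑ i, KZ.of (c i) ∈ planarGroup := by
  sorry

/-- **Stub 2 (scalar calculus inside the planar group).** For a standard density `g`, algebraic
scalars `ν_k` with `Σ ν_k = 0` and cells `e_k` of `|ν_k| · g`, the signed sum
`Σ sign(ν_k) [e_k]` lies in the planar set-chain group (stacking shears `(x, y) ↦ (x, y − a g x)`,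
cuts along graphs, null segments). [folklore] -/
theorem stub_scalarCalculus :
    ∀ (g : ℝ → ℝ),
      (IsSemialgebraicFunOn ℚ {z : Fin 1 → ℝ | z 0 ∈ Set.Ioo (0 : ℝ) 1} (fun z => g (z 0)) ∧
        ContDiffOn ℝ 1 g (Set.Ioo (0 : ℝ) 1) ∧ (∀ x ∈ Set.Ioo (0 : ℝ) 1, 0 < g x) ∧
        IntegrableOn g (Set.Ioo (0 : ℝ) 1)) →
      ∀ (K : Type) [Fintype K] (ν : K → ℝ) (e : K → KZ.IntegralRep 2),
        (∀ k, IsAlgebraic ℚ (ν k)) → ∑ k, ν k = 0 →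
        (∀ k, (e k).domain =
            {p : Fin 2 → ℝ | p 0 ∈ Set.Ioo (0 : ℝ) 1 ∧ 0 < p 1 ∧ p 1 < |ν k| * g (p 0)} ∧
          ∀ p ∈ (e k).domain, (e k).integrand p = 1) →
        ∑ k, (SignType.sign (ν k) : ℤ) • KZ.of (e k) ∈ planarGroup := by
  sorry

/-- **Stub 3′ (Mordell–Weil normal form, shapes (1) ∨ (2) only; the crux-equivalent core).** Every
finite family of standard cells reduces inside the planar set-chain group to algebraic multiples of a
normal basis of standard cells (`[c_k] ≡ Σ_j sign(coef_kj) [d_kj]`, `d_kj` the cell of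
`|coef_kj| · h_j`, values `value c_k = Σ_j coef_kj · value bb_j`), the basis areas being certified
independent in one of TWO shapes: `ℚ̄ ∩ ℝ`-linearly independent outright, or toric
(`1, log bᵢ, arctan βₖ` with `ℚ`-independent complex logarithms `log bᵢ, i·arctan βₖ`). The third
shape of the registered skeleton (formally independent period symbols + `HuberWustholzCurvePeriods`) is
dropped: it is equivalent to the first modulo (HW ∧ soundness of R1–R5)
(`DrefuteFormalIndependence.lean`). `PlanarK0Injective` implies this stub (paper, DREFUTE note). [folklore] -/
theorem stub_mordellWeilNormalForm' :
    ∀ (K : Type) [Fintype K] (g : K → ℝ → ℝ) (c : K → KZ.IntegralRep 2),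
      (∀ k, IsSemialgebraicFunOn ℚ {z : Fin 1 → ℝ | z 0 ∈ Set.Ioo (0 : ℝ) 1} (fun z => g k (z 0)) ∧
        ContDiffOn ℝ 1 (g k) (Set.Ioo (0 : ℝ) 1) ∧ (∀ x ∈ Set.Ioo (0 : ℝ) 1, 0 < g k x) ∧
        IntegrableOn (g k) (Set.Ioo (0 : ℝ) 1)) →
      (∀ k, (c k).domain = {p : Fin 2 → ℝ | p 0 ∈ Set.Ioo (0 : ℝ) 1 ∧ 0 < p 1 ∧ p 1 < g k (p 0)} ∧
        ∀ p ∈ (c k).domain, (c k).integrand p = 1) →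
      ∃ (m : ℕ) (h : Fin m → ℝ → ℝ) (bb : Fin m → KZ.IntegralRep 2) (coef : K → Fin m → ℝ)
        (d : K → Fin m → KZ.IntegralRep 2),
        (∀ j, IsSemialgebraicFunOn ℚ {z : Fin 1 → ℝ | z 0 ∈ Set.Ioo (0 : ℝ) 1} (fun z => h j (z 0)) ∧
          ContDiffOn ℝ 1 (h j) (Set.Ioo (0 : ℝ) 1) ∧ (∀ x ∈ Set.Ioo (0 : ℝ) 1, 0 < h j x) ∧
          IntegrableOn (h j) (Set.Ioo (0 : ℝ) 1)) ∧
        (∀ j, (bb j).domain = {p : Fin 2 → ℝ | p 0 ∈ Set.Ioo (0 : ℝ) 1 ∧ 0 < p 1 ∧ p 1 < h j (p 0)} ∧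
          ∀ p ∈ (bb j).domain, (bb j).integrand p = 1) ∧
        (∀ k j, IsAlgebraic ℚ (coef k j)) ∧
        (∀ k j, (d k j).domain =
            {p : Fin 2 → ℝ | p 0 ∈ Set.Ioo (0 : ℝ) 1 ∧ 0 < p 1 ∧ p 1 < |coef k j| * h j (p 0)} ∧
          ∀ p ∈ (d k j).domain, (d k j).integrand p = 1) ∧
        (∀ k, KZ.of (c k) - ∑ j, (SignType.sign (coef k j) : ℤ) • KZ.of (d k j) ∈ planarGroup) ∧
        (∀ k, (c k).value = ∑ j, coef k j * (bb j).value) ∧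
        ((∀ μ : Fin m → ℝ, (∀ j, IsAlgebraic ℚ (μ j)) → ∑ j, μ j * (bb j).value = 0 → ∀ j, μ j = 0) ∨
          (∃ (p q : ℕ) (b : Fin p → ℝ) (β : Fin q → ℝ) (e : Fin m ≃ Unit ⊕ (Fin p ⊕ Fin q)),
            (∀ i, IsAlgebraic ℚ (b i) ∧ 0 < b i) ∧ (∀ i, IsAlgebraic ℚ (β i)) ∧
            LinearIndependent ℚ (Sum.elim (fun i => ((Real.log (b i) : ℝ) : ℂ))
              (fun i => Complex.I * ((Real.arctan (β i) : ℝ) : ℂ)) : Fin p ⊕ Fin q → ℂ) ∧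
            ∀ j, (bb j).value = Sum.elim (fun _ => (1 : ℝ))
              (Sum.elim (fun i => Real.log (b i)) (fun i => Real.arctan (β i))) (e j))) := by
  sorry

/-- `exp (i · arctan β) = (1 + iβ)/√(1+β²)` is algebraic for real algebraic `β`. [folklore] -/
theorem isAlgebraic_exp_I_mul_arctan {β : ℝ} (hβ : IsAlgebraic ℚ β) :
    IsAlgebraic ℚ (Complex.exp (Complex.I * ((Real.arctan β : ℝ) : ℂ))) := by
  have hsq : IsAlgebraic ℚ (Real.sqrt (1 + β ^ 2)) := by
    have h1 : IsAlgebraic ℚ (1 + β ^ 2) := isAlgebraic_one.add (hβ.pow 2)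
    refine IsAlgebraic.of_pow (n := 2) (by norm_num) ?_
    rw [Real.sq_sqrt (by positivity)]
    exact h1
  have hcos : IsAlgebraic ℚ (Real.cos (Real.arctan β)) := by
    rw [Real.cos_arctan, one_div]
    exact hsq.inv
  have hsin : IsAlgebraic ℚ (Real.sin (Real.arctan β)) := by
    rw [Real.sin_arctan, div_eq_mul_inv]
    exact hβ.mul hsq.inv
  have hI : IsAlgebraic ℚ Complex.I := by
    refine ⟨Polynomial.X ^ 2 + 1, Polynomial.Monic.ne_zero (by monicity!), ?_⟩
    simp
  rw [mul_comm, Complex.exp_mul_I, ← Complex.ofReal_cos, ← Complex.ofReal_sin]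
  exact hcos.algebraMap.add (hsin.algebraMap.mul hI)

/-- `exp (log b) = b` is algebraic for real algebraic `b > 0`. [folklore] -/
theorem isAlgebraic_exp_log {b : ℝ} (hb : IsAlgebraic ℚ b) (hb0 : 0 < b) :
    IsAlgebraic ℚ (Complex.exp ((Real.log b : ℝ) : ℂ)) := by
  rw [← Complex.ofReal_exp, Real.exp_log hb0]
  exact hb.algebraMap

/-- **Baker's theorem in real clothes (was stub 4; PROVED from `baker_holds`).** If `bᵢ > 0` and `βₖ` are
real algebraic numbers such that the complex logarithms `log bᵢ`, `i · arctan βₖ` (logarithms of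
the algebraic numbers `bᵢ` and `(1 + iβₖ)/√(1 + βₖ²)`) are `ℚ`-linearly independent, then
`1, log bᵢ, arctan βₖ` admit no non-trivial vanishing linear combination with real algebraic
coefficients. [cite: Baker1975, Theorem 2.1] -/
theorem stub_toricIndependence :
    ∀ (p q : ℕ) (b : Fin p → ℝ) (β : Fin q → ℝ), (∀ i, IsAlgebraic ℚ (b i)) → (∀ i, 0 < b i) →
      (∀ i, IsAlgebraic ℚ (β i)) →
      LinearIndependent ℚ (Sum.elim (fun i => ((Real.log (b i) : ℝ) : ℂ))
        (fun i => Complex.I * ((Real.arctan (β i) : ℝ) : ℂ)) : Fin p ⊕ Fin q → ℂ) →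
      ∀ μ : Unit ⊕ (Fin p ⊕ Fin q) → ℝ, (∀ j, IsAlgebraic ℚ (μ j)) →
        ∑ j, μ j * Sum.elim (fun _ => (1 : ℝ))
          (Sum.elim (fun i => Real.log (b i)) (fun i => Real.arctan (β i))) j = 0 →
        ∀ j, μ j = 0 := by
  intro p q b β hb hbpos hβ hli μ hμ hsum
  classical
  set l : Fin p ⊕ Fin q → ℂ := Sum.elim (fun i => ((Real.log (b i) : ℝ) : ℂ))
    (fun i => Complex.I * ((Real.arctan (β i) : ℝ) : ℂ)) with hl
  have halg : ∀ i, IsAlgebraic ℚ (Complex.exp (l i)) := by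
    rintro (i | i)
    · simpa [hl] using isAlgebraic_exp_log (hb i) (hbpos i)
    · simpa [hl] using isAlgebraic_exp_I_mul_arctan (hβ i)
  have hB := Literature.NumberTheory.Transcendental.baker_holds l halg hli
  have hI : IsAlgebraic ℚ Complex.I := by
    refine ⟨Polynomial.X ^ 2 + 1, Polynomial.Monic.ne_zero (by monicity!), ?_⟩
    simp
  let cfun : Option (Fin p ⊕ Fin q) → ℂ := fun o =>
    o.elim ((μ (Sum.inl ())) : ℂ)
      (Sum.elim (fun i => ((μ (Sum.inr (Sum.inl i)) : ℝ) : ℂ))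
        (fun k => -Complex.I * ((μ (Sum.inr (Sum.inr k)) : ℝ) : ℂ)))
  have hcalg : ∀ o, IsAlgebraic ℚ (cfun o) := by
    rintro (_ | (i | k))
    · exact (hμ _).algebraMap
    · exact (hμ _).algebraMap
    · exact hI.neg.mul (hμ _).algebraMap
  let g : Option (Fin p ⊕ Fin q) → algebraicClosure ℚ ℂ := fun o =>
    ⟨cfun o, mem_algebraicClosure_iff.mpr (hcalg o)⟩
  have hrel : ∑ o, g o • (o.elim (1 : ℂ) l) = 0 := by
    simp only [IntermediateField.smul_def, smul_eq_mul]
    rw [Fintype.sum_option]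
    simp only [Option.elim_none, Option.elim_some, mul_one]
    rw [Fintype.sum_sum_type]
    have hsumC : ((∑ j, μ j * Sum.elim (fun _ => (1 : ℝ))
        (Sum.elim (fun i => Real.log (b i)) (fun i => Real.arctan (β i))) j : ℝ) : ℂ) = 0 := by
      rw [hsum]; simp
    rw [Fintype.sum_sum_type, Fintype.sum_sum_type] at hsumC
    push_cast at hsumC
    simp only [Finset.univ_unique, Finset.sum_singleton, Sum.elim_inl, Sum.elim_inr] at hsumC
    have key : ∀ k : Fin q, -Complex.I * ((μ (Sum.inr (Sum.inr k)) : ℝ) : ℂ) *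
        (Complex.I * ((Real.arctan (β k) : ℝ) : ℂ)) =
        ((μ (Sum.inr (Sum.inr k)) : ℝ) : ℂ) * ((Real.arctan (β k) : ℝ) : ℂ) := by
      intro k
      have : Complex.I * Complex.I = -1 := Complex.I_mul_I
      linear_combination (-((μ (Sum.inr (Sum.inr k)) : ℝ) : ℂ) * ((Real.arctan (β k) : ℝ) : ℂ)) * this
    simp only [g, cfun, hl, Option.elim_none, Option.elim_some, Sum.elim_inl, Sum.elim_inr, key]
    rw [← hsumC]
    simp
  have h0 := Fintype.linearIndependent_iff.mp hB g hrel
  have hg : ∀ o, cfun o = 0 := fun o => by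
    have := congrArg (fun x : algebraicClosure ℚ ℂ => (x : ℂ)) (h0 o)
    simpa [g] using this
  rintro (u | (i | k))
  · have := hg none
    simp only [cfun, Option.elim_none] at this
    cases u; exact_mod_cast this
  · have := hg (some (Sum.inl i))
    simp only [cfun, Option.elim_some, Sum.elim_inl] at this
    exact_mod_cast this
  · have := hg (some (Sum.inr k))
    simp only [cfun, Option.elim_some, Sum.elim_inr, neg_mul, neg_eq_zero, mul_eq_zero,
      Complex.I_ne_zero, false_or] at this
    exact_mod_cast this

/-! ## Sorry-free composition -/

/-- Independence of the basis areas in the TORIC shape, given Baker (stub 4). [folklore] -/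
theorem valueIndependent_of_toric {m p q : ℕ} (v : Fin m → ℝ) (b : Fin p → ℝ) (β : Fin q → ℝ)
    (e : Fin m ≃ Unit ⊕ (Fin p ⊕ Fin q))
    (hind : ∀ μ : Unit ⊕ (Fin p ⊕ Fin q) → ℝ, (∀ j, IsAlgebraic ℚ (μ j)) →
      ∑ j, μ j * Sum.elim (fun _ => (1 : ℝ))
        (Sum.elim (fun i => Real.log (b i)) (fun i => Real.arctan (β i))) j = 0 → ∀ j, μ j = 0)
    (hv : ∀ j, v j = Sum.elim (fun _ => (1 : ℝ))
      (Sum.elim (fun i => Real.log (b i)) (fun i => Real.arctan (β i))) (e j)) :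
    ∀ μ : Fin m → ℝ, (∀ j, IsAlgebraic ℚ (μ j)) → ∑ j, μ j * v j = 0 → ∀ j, μ j = 0 := by
  intro μ hμ hsum j
  have key := hind (μ ∘ e.symm) (fun j' => hμ _) ?_ (e j)
  · simpa using key
  · rw [← hsum, ← e.symm.sum_comp]
    refine Finset.sum_congr rfl fun j' _ => ?_
    simp [hv]

/-- Soundness of the planar group on a reading: `value r = Σ value (c i)`. [folklore] -/
theorem value_eq_sum_of_mem {n : ℕ} (r : KZ.IntegralRep 2) (c : Fin n → KZ.IntegralRep 2)
    (h : KZ.of r - ∑ i, KZ.of (c i) ∈ planarGroup) : r.value = ∑ i, (c i).value := by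
  have h0 := eval_eq_zero_of_mem_planarGroup h
  rw [map_sub, map_sum, KZ.eval_of] at h0
  simp_rw [KZ.eval_of] at h0
  linarith

/-- **The line concludes the crux BY NAME.** [folklore] -/
theorem PlanarK0Injective_of : PlanarK0Injective := by
  intro r r' hr hr' hval
  classical
  -- Stub 1: read both planar sets as sums of standard cells.
  obtain ⟨n, g, c, hg, hc, hmem⟩ := stub_cellReading r hr
  obtain ⟨n', g', c', hg', hc', hmem'⟩ := stub_cellReading r' hr'
  -- The joint family, indexed by `Fin n ⊕ Fin n'`.
  set K := Fin n ⊕ Fin n' with hK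
  set gK : K → ℝ → ℝ := Sum.elim g g' with hgK
  set cK : K → KZ.IntegralRep 2 := Sum.elim c c' with hcK
  have hgKstd : ∀ k, IsSemialgebraicFunOn ℚ {z : Fin 1 → ℝ | z 0 ∈ Set.Ioo (0 : ℝ) 1}
      (fun z => gK k (z 0)) ∧ ContDiffOn ℝ 1 (gK k) (Set.Ioo (0 : ℝ) 1) ∧
      (∀ x ∈ Set.Ioo (0 : ℝ) 1, 0 < gK k x) ∧ IntegrableOn (gK k) (Set.Ioo (0 : ℝ) 1) := by
    rintro (i | i)
    · exact hg i
    · exact hg' i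
  have hcKcell : ∀ k, (cK k).domain =
      {p : Fin 2 → ℝ | p 0 ∈ Set.Ioo (0 : ℝ) 1 ∧ 0 < p 1 ∧ p 1 < gK k (p 0)} ∧
      ∀ p ∈ (cK k).domain, (cK k).integrand p = 1 := by
    rintro (i | i)
    · exact hc i
    · exact hc' i
  -- Stub 3: normal form of the joint family.
  obtain ⟨m, h, bb, coef, d, hh, hbb, hcoef, hd, hred, hvalue, hind⟩ :=
    stub_mordellWeilNormalForm' K gK cK hgKstd hcKcell
  -- Independence of the basis areas (Baker in the toric shape).
  have hVI : ∀ μ : Fin m → ℝ, (∀ j, IsAlgebraic ℚ (μ j)) → ∑ j, μ j * (bb j).value = 0 →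
      ∀ j, μ j = 0 := by
    rcases hind with hdirect | ⟨p, q, b, β, e, hb, hβ, hli, hv⟩
    · exact hdirect
    · exact valueIndependent_of_toric (fun j => (bb j).value) b β e
        (stub_toricIndependence p q b β (fun i => (hb i).1) (fun i => (hb i).2) hβ hli) hv
  -- Equal areas force equal normal coordinates.
  set μ : Fin m → ℝ := fun j => (∑ i, coef (Sum.inl i) j) - ∑ i, coef (Sum.inr i) j with hμ
  have hμalg : ∀ j, IsAlgebraic ℚ (μ j) := by
    intro j
    rw [← mem_algebraicClosure_iff]
    refine Subalgebra.sub_mem _ (Subalgebra.sum_mem _ fun i _ => ?_)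
      (Subalgebra.sum_mem _ fun i _ => ?_)
    · exact mem_algebraicClosure_iff.mpr (hcoef _ _)
    · exact mem_algebraicClosure_iff.mpr (hcoef _ _)
  have hrsum : r.value = ∑ i, ∑ j, coef (Sum.inl i) j * (bb j).value := by
    rw [value_eq_sum_of_mem r c hmem]
    exact Finset.sum_congr rfl fun i _ => hvalue (Sum.inl i)
  have hr'sum : r'.value = ∑ i, ∑ j, coef (Sum.inr i) j * (bb j).value := by
    rw [value_eq_sum_of_mem r' c' hmem']
    exact Finset.sum_congr rfl fun i _ => hvalue (Sum.inr i)
  have hμsum : ∑ j, μ j * (bb j).value = 0 := by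
    have e1 : ∑ j, μ j * (bb j).value =
        (∑ i, ∑ j, coef (Sum.inl i) j * (bb j).value) -
          ∑ i, ∑ j, coef (Sum.inr i) j * (bb j).value := by
      rw [Finset.sum_comm (f := fun i j => coef (Sum.inl i) j * (bb j).value),
        Finset.sum_comm (f := fun i j => coef (Sum.inr i) j * (bb j).value),
        ← Finset.sum_sub_distrib]
      refine Finset.sum_congr rfl fun j _ => ?_
      rw [hμ]
      simp only
      rw [sub_mul, Finset.sum_mul, Finset.sum_mul]
    rw [e1, ← hrsum, ← hr'sum, hval, sub_self]
  have hμ0 : ∀ j, μ j = 0 := hVI μ hμalg hμsum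
  -- Stub 2, coordinate by coordinate.
  have hcoord : ∀ j, (∑ i, (SignType.sign (coef (Sum.inl i) j) : ℤ) • KZ.of (d (Sum.inl i) j)) -
      ∑ i, (SignType.sign (coef (Sum.inr i) j) : ℤ) • KZ.of (d (Sum.inr i) j) ∈ planarGroup := by
    intro j
    set ν : K → ℝ := Sum.elim (fun i => coef (Sum.inl i) j) (fun i => -coef (Sum.inr i) j)
      with hν
    have hνalg : ∀ k, IsAlgebraic ℚ (ν k) := by
      rintro (i | i)
      · exact hcoef _ _
      · simpa [hν] using (hcoef (Sum.inr i) j).neg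
    have hνsum : ∑ k, ν k = 0 := by
      rw [Fintype.sum_sum_type]
      simp only [hν, Sum.elim_inl, Sum.elim_inr, Finset.sum_neg_distrib]
      have := hμ0 j
      rw [hμ] at this
      simp only at this
      linarith
    have hνcell : ∀ k, (d k j).domain =
        {p : Fin 2 → ℝ | p 0 ∈ Set.Ioo (0 : ℝ) 1 ∧ 0 < p 1 ∧ p 1 < |ν k| * h j (p 0)} ∧
        ∀ p ∈ (d k j).domain, (d k j).integrand p = 1 := by
      rintro (i | i)
      · simpa [hν] using hd (Sum.inl i) j
      · simpa [hν, abs_neg] using hd (Sum.inr i) j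
    have key := stub_scalarCalculus (h j) (hh j) K ν (fun k => d k j) hνalg hνsum hνcell
    rw [Fintype.sum_sum_type] at key
    simpa [hν, Left.sign_neg, sub_eq_add_neg] using key
  -- Assemble inside the planar group.
  have hsum1 : (∑ i, KZ.of (c i)) - ∑ i, ∑ j, (SignType.sign (coef (Sum.inl i) j) : ℤ) •
      KZ.of (d (Sum.inl i) j) ∈ planarGroup := by
    rw [← Finset.sum_sub_distrib]
    exact AddSubgroup.sum_mem _ fun i _ => hred (Sum.inl i)
  have hsum2 : (∑ i, KZ.of (c' i)) - ∑ i, ∑ j, (SignType.sign (coef (Sum.inr i) j) : ℤ) •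
      KZ.of (d (Sum.inr i) j) ∈ planarGroup := by
    rw [← Finset.sum_sub_distrib]
    exact AddSubgroup.sum_mem _ fun i _ => hred (Sum.inr i)
  have hsum3 : (∑ i, ∑ j, (SignType.sign (coef (Sum.inl i) j) : ℤ) • KZ.of (d (Sum.inl i) j)) -
      ∑ i, ∑ j, (SignType.sign (coef (Sum.inr i) j) : ℤ) • KZ.of (d (Sum.inr i) j) ∈ planarGroup := by
    rw [Finset.sum_comm (f := fun i j => (SignType.sign (coef (Sum.inl i) j) : ℤ) • KZ.of (d (Sum.inl i) j)),
      Finset.sum_comm (f := fun i j => (SignType.sign (coef (Sum.inr i) j) : ℤ) • KZ.of (d (Sum.inr i) j)),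
      ← Finset.sum_sub_distrib]
    exact AddSubgroup.sum_mem _ fun j _ => hcoord j
  have h4 : (∑ i, KZ.of (c i)) - ∑ i, KZ.of (c' i) ∈ planarGroup := by
    have := planarGroup.add_mem (planarGroup.sub_mem hsum1 hsum2) hsum3
    convert this using 1
    abel
  have h5 : KZ.of r - KZ.of r' ∈ planarGroup := by
    have := planarGroup.add_mem (planarGroup.sub_mem hmem hmem') h4
    convert this using 1
    abel
  exact h5

end Summit.KontsevichZagierPeriods.SymplecticScissors.MordellWeilCorrected

end
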